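import Summits.QuantumFields.BalabanUV.T4Continuum.Support.NE7DecompOfLettersGeneric
import HarnessLib

/-!
# NE7DecompOfLettersGenericFixed — `NE7DecompOfLettersGeneric.decomp_of_letters` WITH THE GAUGE AND THE REPRESENTATIVE KEPT (not re-packaged under `∃`): the two weighted letters of a
# normal part `X_N` (`‖X_N‖_w ≤ √(c₁+c₂)·q₂·‖X₀‖_w`, `(ε∕M²)Σ‖curl X_N‖ ≤ ε·c₃·q₁·‖X₀‖_w²`) from its three ℓ-letters against a coarse datum `φ` and the two direct letters of `φ`

Cell `pub-balaban`, rung (B)+1 sub-cell t4, lineage `b2b-balaban-t4-ne7-p1`, generation 105 (CRUX PROVER NE7 #1 = OWNER of BINDER row NE7).  Memo `t4/b2b-balaban-t4-ne7-p1-g105/ROAD-G105.md` §1.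
WHY.  Gen 104's `decomp_of_letters` returns `∃ u X X_T X_N …`, hiding that its gauge is the INPUT gauge `u` (periodic, corner data known) and its representative the INPUT `X₀`; the
T-E_w♯ assembly of this generation (node NE3's re-typed root at SU(2), `L = 2`) needs the periodicity of `u` and the accumulated-frame bound of `X_T = X₀ − X_N`, i.e. the letters
about the GIVEN objects.  THIS FILE is `decomp_of_letters` with the conclusion stated for the given `u`, `X₀`, `X_N` (same letters as hypotheses, the now idle gauge∕sup binders dropped;
proof = gen 104's arithmetic verbatim).
WHAT ([folklore]; 0 def, 0 sorry).  **`decomp_of_letters_fixed`**: (R1)–(R3) for `X_N` against `φ` with constants `c₁ c₂ c₃`, (DL2)∕(DL1) for `φ` with `q₂ q₁` ⟹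
`X₀ = (X₀ − X_N) + X_N`, `X_N` skew, `‖X_N‖_w ≤ √(c₁+c₂)·q₂·‖X₀‖_w`, `(ε∕M²)·Σ_{perWin}‖curl U♯ X_N‖ ≤ ε·c₃·q₁·‖X₀‖_w²`.
HONEST FRAMING (page 1): bookkeeping (pure real arithmetic); every letter is a displayed hypothesis asserted for nothing; nothing of Bałaban's asserted; NOT NE7, NOT NE3; spine 0∕9; finite T⁴
rung (B)+1 — NOT infinite volume, NOT mass gap, NOT BetaPertH, NOT Clay (continuum YM on T⁴ ⇐ BetaPertH ∧ nine spine estimates, 0/9 proved).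
-/

set_option autoImplicit false

open scoped BigOperators Matrix Matrix.Norms.L2Operator
open NormedSpace Finset Set

namespace Summit.QuantumFields.BalabanUV.T4Continuum.NE7DecompOfLettersGenericFixed

open Literature.MathematicalPhysics.QuantumFieldTheory.Balaban1983to89
open B7Prop1Explicit B7Prop2Explicit
open T4AveragingDeficitWall (IsUnitaryCfg IsSkewDir SmallField vary curl curlSq dirSq dirL1)
open T4AveragingDeficitWallBoundary (IsPeriodicCfg periodBox)
open AveragingDeficitPeriodicCounting (IsPeriodicDir)
open MinimalActionLevels (perWin)
open NE3EnergyShapes (IsUnitarySite IsPeriodicSite)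
open NE3EnergyWeightedShapes (energyNormW energyNormW_nonneg)
open NE3ProductPathBounds (energySq_nonneg)
open NE3EnergyHessContTwoTerm (curlSq_nonneg dirSq_nonneg)

noncomputable section

variable {d : ℕ} {n : Type*} [Fintype n] [DecidableEq n]

/-- **THE TWO WEIGHTED LETTERS OF A GIVEN NORMAL PART** — `decomp_of_letters` with the gauge `u`, the representative `X₀` and the normal part `X_N` kept in the conclusion (the idle gauge∕sup
binders of gen 104's statement dropped). [folklore] -/
theorem decomp_of_letters_fixed [Nonempty n] {L N : ℕ} [NeZero L] [NeZero N] (k : ℕ) {ε : ℝ} (hε : 0 < ε)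
    {Us : Site d → Fin d → (Matrix n n ℂ)ˣ}
    (𝒯 : ℕ → (Site d → Fin d → (Matrix n n ℂ)ˣ) → Set (Site d → Fin d → Matrix n n ℂ)) (hTs : ∀ Y ∈ 𝒯 k Us, IsSkewDir Y)
    {φ : Site d → Fin d → Matrix n n ℂ}
    {X₀ XN : Site d → Fin d → Matrix n n ℂ} {q₂ q₁ c₁ c₂ c₃ : ℝ} (hq₂ : 0 ≤ q₂) (hc₁ : 0 ≤ c₁) (hc₂ : 0 ≤ c₂) (hc₃ : 0 ≤ c₃)
    (hXs : IsSkewDir X₀)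
    (hslice : (fun y μ => X₀ y μ - XN y μ) ∈ 𝒯 k Us)
    (hR1 : dirSq XN (periodBox (d := d) (N * L ^ (k + 1)))
      ≤ c₁ * (((L : ℝ) ^ (k + 1)) ^ d / ((L : ℝ) ^ (k + 1)) ^ 2) * dirSq φ (periodBox (d := d) N))
    (hR2 : curlSq Us XN (periodBox (d := d) (N * L ^ (k + 1)))
      ≤ c₂ * (((L : ℝ) ^ (k + 1)) ^ d / ((L : ℝ) ^ (k + 1)) ^ 4) * dirSq φ (periodBox (d := d) N))
    (hR3 : ∑ p ∈ perWin d (N * L ^ (k + 1)), ‖curl Us XN p‖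
      ≤ c₃ * (((L : ℝ) ^ (k + 1)) ^ d / ((L : ℝ) ^ (k + 1)) ^ 2) * dirL1 φ (periodBox (d := d) N))
    (hDL2 : ((L : ℝ) ^ (k + 1)) ^ d / ((L : ℝ) ^ (k + 1)) ^ 4 * dirSq φ (periodBox (d := d) N)
      ≤ q₂ ^ 2 * energyNormW L (k + 1) Us X₀ (periodBox (d := d) (N * L ^ (k + 1))) ^ 2)
    (hDL1 : ((L : ℝ) ^ (k + 1)) ^ d / ((L : ℝ) ^ (k + 1)) ^ 4 * dirL1 φ (periodBox (d := d) N)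
      ≤ q₁ * energyNormW L (k + 1) Us X₀ (periodBox (d := d) (N * L ^ (k + 1))) ^ 2) :
    X₀ = (fun y μ => X₀ y μ - XN y μ) + XN ∧ IsSkewDir XN ∧ 0 ≤ Real.sqrt (c₁ + c₂) * q₂ ∧
      energyNormW L (k + 1) Us XN (periodBox (d := d) (N * L ^ (k + 1)))
        ≤ (Real.sqrt (c₁ + c₂) * q₂) * energyNormW L (k + 1) Us X₀ (periodBox (d := d) (N * L ^ (k + 1))) ∧
      ε / ((L : ℝ) ^ (k + 1)) ^ 2 * (∑ p ∈ perWin d (N * L ^ (k + 1)), ‖curl Us XN p‖)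
        ≤ (ε * c₃ * q₁) * energyNormW L (k + 1) Us X₀ (periodBox (d := d) (N * L ^ (k + 1))) ^ 2 := by
  have hL0 : 0 < L := Nat.pos_of_ne_zero (NeZero.ne L)
  set M : ℝ := (L : ℝ) ^ (k + 1) with hMdef
  have hM0 : 0 < M := by positivity
  set F := periodBox (d := d) (N * L ^ (k + 1)) with hF
  -- skewness of `XN` from the slice part
  have hTsk : IsSkewDir (fun y μ => X₀ y μ - XN y μ) := hTs _ hslice
  have hNsk : IsSkewDir XN := fun y μ => by
    have e : XN y μ = X₀ y μ - (X₀ y μ - XN y μ) := (sub_sub_cancel _ _).symm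
    rw [e]; exact (skewAdjoint (Matrix n n ℂ)).sub_mem (hXs y μ) (hTsk y μ)
  -- energies
  set EX : ℝ := energyNormW L (k + 1) Us X₀ F with hEX
  set EN : ℝ := energyNormW L (k + 1) Us XN F with hEN
  have hEX0 : 0 ≤ EX := energyNormW_nonneg _ _ _ _ _
  have hEN0 : 0 ≤ EN := energyNormW_nonneg _ _ _ _ _
  have hdφ0 : 0 ≤ dirSq φ (periodBox (d := d) N) := dirSq_nonneg _ _
  -- (R1)(R2)(DL2) ⇒ `EN² ≤ (c₁+c₂)·(M^d/M⁴)·dirSq φ ≤ (c₁+c₂) q₂² EX²`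
  have hENsq : EN ^ 2 = curlSq Us XN F + (M⁻¹) ^ 2 * dirSq XN F := by
    rw [hEN]; unfold NE3EnergyWeightedShapes.energyNormW
    rw [Real.sq_sqrt (energySq_nonneg L (k + 1) Us XN F)]
  have hEN2 : EN ^ 2 ≤ (c₁ + c₂) * (q₂ ^ 2 * EX ^ 2) := by
    have h1 : (M⁻¹) ^ 2 * dirSq XN F ≤ (M⁻¹) ^ 2 * (c₁ * (M ^ d / M ^ 2) * dirSq φ (periodBox (d := d) N)) :=
      mul_le_mul_of_nonneg_left hR1 (by positivity)
    have h2 : (M⁻¹) ^ 2 * (c₁ * (M ^ d / M ^ 2) * dirSq φ (periodBox (d := d) N)) = c₁ * (M ^ d / M ^ 4 * dirSq φ (periodBox (d := d) N)) := by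
      field_simp
    have h2' : c₂ * (M ^ d / M ^ 4) * dirSq φ (periodBox (d := d) N) = c₂ * (M ^ d / M ^ 4 * dirSq φ (periodBox (d := d) N)) := by ring
    have h3 : EN ^ 2 ≤ (c₁ + c₂) * (M ^ d / M ^ 4 * dirSq φ (periodBox (d := d) N)) := by
      rw [hENsq]
      have h12 := add_le_add hR2 h1
      rw [h2, h2'] at h12
      linarith
    exact h3.trans (by nlinarith [hDL2, hc₁, hc₂])
  have hN1 : EN ≤ Real.sqrt (c₁ + c₂) * q₂ * EX := by
    have hr : 0 ≤ Real.sqrt (c₁ + c₂) * q₂ * EX := mul_nonneg (mul_nonneg (Real.sqrt_nonneg _) hq₂) hEX0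
    have hs2 : Real.sqrt (c₁ + c₂) ^ 2 = c₁ + c₂ := Real.sq_sqrt (add_nonneg hc₁ hc₂)
    have hsq' : EN ^ 2 ≤ (Real.sqrt (c₁ + c₂) * q₂ * EX) ^ 2 := by
      have e : (Real.sqrt (c₁ + c₂) * q₂ * EX) ^ 2 = Real.sqrt (c₁ + c₂) ^ 2 * (q₂ ^ 2 * EX ^ 2) := by ring
      rw [e, hs2]; exact hEN2
    exact (pow_le_pow_iff_left₀ hEN0 hr (by norm_num : (2 : ℕ) ≠ 0)).1 hsq'
  -- (R3)(DL1) ⇒ the ℓ¹-curl letter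
  have hN2 : ε / M ^ 2 * (∑ p ∈ perWin d (N * L ^ (k + 1)), ‖curl Us XN p‖) ≤ ε * c₃ * q₁ * EX ^ 2 := by
    have h1 : ε / M ^ 2 * (∑ p ∈ perWin d (N * L ^ (k + 1)), ‖curl Us XN p‖)
        ≤ ε / M ^ 2 * (c₃ * (M ^ d / M ^ 2) * dirL1 φ (periodBox (d := d) N)) := mul_le_mul_of_nonneg_left hR3 (by positivity)
    have h2 : ε / M ^ 2 * (c₃ * (M ^ d / M ^ 2) * dirL1 φ (periodBox (d := d) N)) = ε * c₃ * (M ^ d / M ^ 4 * dirL1 φ (periodBox (d := d) N)) := by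
      field_simp
    rw [h2] at h1
    have h3 : ε * c₃ * (M ^ d / M ^ 4 * dirL1 φ (periodBox (d := d) N)) ≤ ε * c₃ * (q₁ * EX ^ 2) :=
      mul_le_mul_of_nonneg_left hDL1 (by positivity)
    linarith
  refine ⟨?_, hNsk, by positivity, hN1, hN2⟩
  funext y μ; simp only [Pi.add_apply, sub_add_cancel]

end

end Summit.QuantumFields.BalabanUV.T4Continuum.NE7DecompOfLettersGenericFixed
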